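import Mathlib.Analysis.SpecialFunctions.Log.NegMulLog
import Mathlib.Analysis.Convex.Jensen
import Mathlib.Algebra.Order.BigOperators.Ring.Finset
import Mathlib.Data.Finset.Prod
import Mathlib.Algebra.BigOperators.Field
import HarnessLib

/-!
# Shannon entropy of random variables on a finite weighted set

Topic `Literature/Probability/Entropy`. Everything in this file is PROVED (no named facts).

The elementary Shannon-entropy toolkit for **discrete random variables on a finite probability
space given by positive weights**, in the form reviewed in §3 of Tao's paper on the
logarithmically averaged Chowla conjecture (Tao 2016, (3.1)–(3.7)), where it drives the "entropy
decrement argument" (Lemma 3.2) and the weak uniform distribution lemma (Lemma 3.3). It is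
written for the proof of `Literature.NumberTheory.LFunctions.Tao2016_theorem23` / `Literature.NumberTheory.Sieve.tao_log_chowla_liouville`
(Tao 2016, Thm 2.3 / Thm 1.2), whose probability space is the finite set
`{n : x/ω < n ≤ x}` with the logarithmic weights `1/n`; neither Mathlib nor the tree has Shannon
entropy of random variables (Mathlib has `Real.negMulLog`, its concavity, and measure-theoretic
Kullback–Leibler divergence; `lean search 'entropy'` finds only topological entropy and two
unrelated Literature notions).

## Setting

A finite index set `s : Finset ι` with weights `w : ι → ℝ` (meant to be nonnegative; most
statements assume `∀ i ∈ s, 0 ≤ w i`), random variables are arbitrary maps `X : ι → α` into types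
with decidable equality, and

* `mass s w = ∑_{i ∈ s} w i`, `prob s w X a = w({X = a}) / w(s)` (`= 0` when `w(s) = 0`);
* `ent s w X = ∑_{a ∈ X(s)} φ(P(X = a))`, `φ = Real.negMulLog` (`φ(x) = -x log x`), i.e.
  `H(X) = ∑_x P(X = x) log (1/P(X = x))` (Tao 2016, §3);
* `condEnt s w X Y = ∑_b P(Y = b) H[X | Y = b]` with `H[X | Y = b]` the entropy on the fibre
  `s.filter (Y · = b)` with the induced weights (Tao 2016, (3.2)) — conditioning on an event is
  restriction of `s`, so every statement applies verbatim to conditioned variables;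
* `mutualInfo s w X Y = H[X] + H[Y] - H[X, Y]` (Tao 2016, (3.5)).

## Content

* `ent_pair_eq_add_condEnt` — chain rule `H[X, Y] = H[Y] + H[X | Y]` (3.1);
* `condEnt_le_ent` — `H[X | Y] ≤ H[X]` (3.3) (Jensen for the concave `φ`,
  Mathlib `Real.concaveOn_negMulLog`, `ConcaveOn.le_map_sum`); `ent_pair_le_add` (3.4);
  `mutualInfo_nonneg`, `mutualInfo_eq_ent_sub_condEnt(')` (3.5); `condEnt_pair_le_add` (3.6);
  `ent_le_log_card` — `H[X] ≤ log N` for `N` values (3.7); `ent_eq_log_card_of_uniform`;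
* invariances: `ent_comp_of_injOn`, `ent_pair_comm`, `ent_pair_apply_eq` (`H[X, f(X)] = H[X]`),
  `condEnt_comp_left_of_injOn`, `condEnt_comp_right_of_injOn` (relabelling the conditioning
  variable injectively: "conveys exactly the same information", proof of (3.13));
* `mutualInfo_eq_sum_fiber` — `I[X : Y] = ∑_x P(X = x)(H[Y] - H[Y | X = x])`;
  `ent_le_of_event` — `H[Y] ≤ log 2 + P(Y ∈ T) log #T + (1 - P(Y ∈ T)) log #t` for `Y(s) ⊆ t`
  (the computation in the proof of Lemma 3.3);
* continuity of entropy in the law: `abs_negMulLog_sub_le` (`|φ(p) - φ(q)| ≤ φ(|p-q|) + |p-q|`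
  on `[0,1]`) and `abs_ent_sub_ent_le` — laws `δ`-close pointwise on a set of `N` values have
  entropies within `N(φ(δ) + δ)` (used for the approximate translation invariance (3.11));
* `neg_log_le_ent` (`H[X] ≥ -log q` when every atom has probability `≤ q`),
  `ent_eq_zero_of_subsingleton`, `condEnt_eq_zero_of_subsingleton`, `prob_congr`, and
  **Tao's Lemma 3.3 (weak uniform distribution) in averaged form** `prob_mem_le_of_mutualInfo`:
  if `Y` takes values in `[0, P)` and `#E_x ≤ e^{-B} P` for every `x`, then
  `P(Y ∈ E_X) ≤ (log 2 + (log P - H[Y]) + I[X : Y]) / B` — on each fibre `{X = x}` this is the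
  computation of the proof of Lemma 3.3, and the average over `x` absorbs the Markov step with
  which the paper selects "good" values `x`.

## References
* T. Tao, *The logarithmically averaged Chowla and Elliott conjectures for two-point
  correlations*, Forum Math. Pi 4 (2016), e8; arXiv:1509.05422, §3, (3.1)–(3.7).
* T. M. Cover, J. A. Thomas, *Elements of Information Theory*, 2nd ed., Wiley 2006, Ch. 2
  (Thms 2.2.1, 2.5.1, 2.6.4, 2.6.5) — the standard source of these inequalities.

## Design choices
* Weights rather than a probability measure: the application conditions repeatedly on events and
  on values of random variables, which here is just `Finset.filter`; no measurability, and all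
  sums are finite. Values of probability `0` contribute `φ(0) = 0`, so entropies may be computed
  over any finite superset of the range (`ent_eq_sum_of_subset`, `condEnt_eq_sum_of_subset`).
* Natural logarithms, as in the source.
-/

open Finset Real

noncomputable section

namespace Literature.Probability.Entropy

namespace FiniteShannon

variable {ι α β γ : Type*}

/-! ### Mass and probability -/

/-- Total weight `w(s) = ∑_{i ∈ s} w i` of a finite set. [folklore] -/
def mass (s : Finset ι) (w : ι → ℝ) : ℝ := ∑ i ∈ s, w i

/-- The probability `P(X = a) = w({i ∈ s : X i = a}) / w(s)` of the value `a` of the random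
variable `X` on the finite weighted set `(s, w)` (`= 0` if `w(s) = 0`). [folklore] -/
def prob [DecidableEq α] (s : Finset ι) (w : ι → ℝ) (X : ι → α) (a : α) : ℝ :=
  mass (s.filter fun i => X i = a) w / mass s w

/-- The **Shannon entropy** `H[X] = ∑_a P(X = a) log (1 / P(X = a))` of a random variable on a
finite weighted set (natural logarithm; the sum is over the values taken on `s`).
[cite: TaoFMP2016, §3 (definition of `H(X)`)] -/
def ent [DecidableEq α] (s : Finset ι) (w : ι → ℝ) (X : ι → α) : ℝ :=
  ∑ a ∈ s.image X, negMulLog (prob s w X a)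

/-- The **conditional Shannon entropy** `H[X | Y] = ∑_b P(Y = b) H[X | Y = b]`, where
`H[X | Y = b]` is the entropy of `X` on the fibre `{i ∈ s : Y i = b}` with the induced weights.
[cite: TaoFMP2016, §3 (3.2)] -/
def condEnt [DecidableEq α] [DecidableEq β] (s : Finset ι) (w : ι → ℝ) (X : ι → α) (Y : ι → β) :
    ℝ :=
  ∑ b ∈ s.image Y, prob s w Y b * ent (s.filter fun i => Y i = b) w X

/-- The **mutual information** `I[X : Y] = H[X] + H[Y] - H[X, Y]`. [cite: TaoFMP2016, §3 (3.5)] -/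
def mutualInfo [DecidableEq α] [DecidableEq β] (s : Finset ι) (w : ι → ℝ) (X : ι → α)
    (Y : ι → β) : ℝ :=
  ent s w X + ent s w Y - ent s w (fun i => (X i, Y i))

section Mass

variable {s : Finset ι} {w : ι → ℝ}

/-- Unfolding `mass`. [folklore] -/
theorem mass_def (s : Finset ι) (w : ι → ℝ) : mass s w = ∑ i ∈ s, w i := rfl

/-- `w(s) ≥ 0` for nonnegative weights. [folklore] -/
theorem mass_nonneg (hw : ∀ i ∈ s, 0 ≤ w i) : 0 ≤ mass s w := sum_nonneg hw

/-- `w(s) > 0` for positive weights on a nonempty set. [folklore] -/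
theorem mass_pos (hw : ∀ i ∈ s, 0 < w i) (hs : s.Nonempty) : 0 < mass s w :=
  sum_pos hw hs

/-- Monotonicity of `mass` in the set, for nonnegative weights. [folklore] -/
theorem mass_le_mass_of_subset {t : Finset ι} (hts : t ⊆ s) (hw : ∀ i ∈ s, 0 ≤ w i) :
    mass t w ≤ mass s w :=
  sum_le_sum_of_subset_of_nonneg hts fun i hi _ => hw i hi

/-- `mass` of a filter is at most the whole mass. [folklore] -/
theorem mass_filter_le (p : ι → Prop) [DecidablePred p] (hw : ∀ i ∈ s, 0 ≤ w i) :
    mass (s.filter p) w ≤ mass s w :=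
  mass_le_mass_of_subset (filter_subset _ _) hw

/-- Fibrewise decomposition of the mass: `w(s) = ∑_{b ∈ t} w({i ∈ s : Y i = b})` whenever `Y`
maps `s` into `t`. [folklore] -/
theorem mass_eq_sum_mass_fiber [DecidableEq β] (Y : ι → β) {t : Finset β}
    (ht : ∀ i ∈ s, Y i ∈ t) :
    mass s w = ∑ b ∈ t, mass (s.filter fun i => Y i = b) w := by
  unfold mass
  exact (sum_fiberwise_of_maps_to ht _).symm

end Mass

section Prob

variable [DecidableEq α] [DecidableEq β] {s : Finset ι} {w : ι → ℝ} {X : ι → α}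

/-- Unfolding `prob`. [folklore] -/
theorem prob_def (s : Finset ι) (w : ι → ℝ) (X : ι → α) (a : α) :
    prob s w X a = mass (s.filter fun i => X i = a) w / mass s w := rfl

/-- `P(X = a) ≥ 0`. [folklore] -/
theorem prob_nonneg (hw : ∀ i ∈ s, 0 ≤ w i) (a : α) : 0 ≤ prob s w X a :=
  div_nonneg (mass_nonneg fun i hi => hw i (mem_of_mem_filter i hi)) (mass_nonneg hw)

/-- `P(X = a) ≤ 1`. [folklore] -/
theorem prob_le_one (hw : ∀ i ∈ s, 0 ≤ w i) (a : α) : prob s w X a ≤ 1 := by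
  unfold prob
  rcases (mass_nonneg hw).eq_or_lt with h | h
  · rw [← h, div_zero]; exact zero_le_one
  · rw [div_le_one h]; exact mass_filter_le _ hw

/-- `P(X = a) = 0` if `a` is not a value of `X` on `s`. [folklore] -/
theorem prob_eq_zero_of_not_mem_image {a : α} (ha : a ∉ s.image X) : prob s w X a = 0 := by
  unfold prob
  have : s.filter (fun i => X i = a) = ∅ := by
    rw [filter_eq_empty_iff]
    intro i hi hia
    exact ha (mem_image.2 ⟨i, hi, hia⟩)
  rw [this, mass_def, sum_empty, zero_div]

/-- `P(X = a) > 0` if `a` is a value of `X` on `s` and the weights are positive. [folklore] -/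
theorem prob_pos (hw : ∀ i ∈ s, 0 < w i) {a : α} (ha : a ∈ s.image X) : 0 < prob s w X a := by
  unfold prob
  obtain ⟨i, hi, hia⟩ := mem_image.1 ha
  refine div_pos (mass_pos (fun j hj => hw j (mem_of_mem_filter j hj)) ⟨i, ?_⟩)
    (mass_pos hw ⟨i, hi⟩)
  exact mem_filter.2 ⟨hi, hia⟩

/-- The probabilities of the values in any `t ⊇ X(s)` sum to `1` (positive total weight).
[folklore] -/
theorem sum_prob_eq_one (hs : 0 < mass s w) {t : Finset α}
    (ht : s.image X ⊆ t) : ∑ a ∈ t, prob s w X a = 1 := by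
  unfold prob
  rw [← Finset.sum_div, ← mass_eq_sum_mass_fiber X fun i hi => ht (mem_image_of_mem X hi),
    div_self hs.ne']

/-- Law of total probability: `P(X = a) = ∑_{b ∈ t} P(X = a, Y = b)` for `t ⊇ Y(s)`. [folklore] -/
theorem prob_eq_sum_prob_pair {Y : ι → β} {t : Finset β} (ht : ∀ i ∈ s, Y i ∈ t) (a : α) :
    prob s w X a = ∑ b ∈ t, prob s w (fun i => (X i, Y i)) (a, b) := by
  unfold prob
  rw [← Finset.sum_div]
  congr 1
  rw [mass_eq_sum_mass_fiber Y (t := t) fun i hi => ht i (mem_of_mem_filter i hi)]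
  refine sum_congr rfl fun b _ => ?_
  unfold mass
  rw [filter_filter]
  refine sum_congr ?_ fun _ _ => rfl
  ext i
  simp only [mem_filter, Prod.mk.injEq]

/-- `P(X = a, Y = b) = P(Y = b) · P(X = a | Y = b)`, the conditional probability being the
probability on the fibre `{Y = b}`. [folklore] -/
theorem prob_pair_eq_mul (hw : ∀ i ∈ s, 0 ≤ w i) (Y : ι → β) (a : α) (b : β) :
    prob s w (fun i => (X i, Y i)) (a, b) =
      prob s w Y b * prob (s.filter fun i => Y i = b) w X a := by
  unfold prob
  have hfilt : (s.filter fun i => Y i = b).filter (fun i => X i = a) =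
      s.filter fun i => (X i, Y i) = (a, b) := by
    rw [filter_filter]
    ext i
    simp only [mem_filter, Prod.mk.injEq]
    tauto
  rw [hfilt]
  rcases (mass_nonneg (fun i hi => hw i (mem_of_mem_filter i hi)) :
    0 ≤ mass (s.filter fun i => Y i = b) w).eq_or_lt with h0 | hpos
  · -- the fibre has mass zero, hence so does the sub-fibre
    have hsub : mass (s.filter fun i => (X i, Y i) = (a, b)) w = 0 := by
      refine le_antisymm ?_ (mass_nonneg fun i hi => hw i (mem_of_mem_filter i hi))
      rw [← hfilt, h0]
      exact mass_filter_le _ fun i hi => hw i (mem_of_mem_filter i hi)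
    rw [hsub, ← h0]
    simp
  · rw [div_mul_div_comm, mul_comm (mass (s.filter fun i => Y i = b) w), ← div_mul_div_comm,
      div_self hpos.ne', mul_one]

end Prob


section Ent

variable [DecidableEq α] [DecidableEq β] [DecidableEq γ] {s : Finset ι} {w : ι → ℝ} {X : ι → α}
  {Y : ι → β}

/-- Unfolding `ent`. [folklore] -/
theorem ent_def (s : Finset ι) (w : ι → ℝ) (X : ι → α) :
    ent s w X = ∑ a ∈ s.image X, negMulLog (prob s w X a) := rfl

/-- The entropy may be computed by summing over any finite set of values containing `X(s)`.
[folklore] -/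
theorem ent_eq_sum_of_subset {t : Finset α} (ht : s.image X ⊆ t) :
    ent s w X = ∑ a ∈ t, negMulLog (prob s w X a) := by
  unfold ent
  refine sum_subset ht fun a _ ha => ?_
  rw [prob_eq_zero_of_not_mem_image ha, negMulLog_zero]

/-- `H[X] ≥ 0`. [folklore] -/
theorem ent_nonneg (hw : ∀ i ∈ s, 0 ≤ w i) : 0 ≤ ent s w X :=
  sum_nonneg fun a _ => negMulLog_nonneg (prob_nonneg hw a) (prob_le_one hw a)

/-- `H[X] = 0` on a set of total weight zero (in particular on `∅`). [folklore] -/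
theorem ent_eq_zero_of_mass_eq_zero (h : mass s w = 0) : ent s w X = 0 := by
  unfold ent prob
  simp [h]

/-- A set of positive total weight is nonempty. [folklore] -/
theorem nonempty_of_mass_pos (h : 0 < mass s w) : s.Nonempty := by
  by_contra h'
  rw [not_nonempty_iff_eq_empty] at h'
  rw [h', mass_def, sum_empty] at h
  exact lt_irrefl _ h

/-- **Entropy is at most `log` of the number of values** (Tao 2016, (3.7)): if `X(s) ⊆ t` then
`H[X] ≤ log #t`. Proof: `∑ p_a log (1/(N p_a)) ≤ ∑ p_a (1/(N p_a) - 1) ≤ 0`.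
[cite: TaoFMP2016, §3 (3.7)] -/
theorem ent_le_log_card (hw : ∀ i ∈ s, 0 ≤ w i) {t : Finset α} (ht : s.image X ⊆ t) :
    ent s w X ≤ Real.log (#t) := by
  rcases (mass_nonneg hw).eq_or_lt with h0 | hpos
  · rw [ent_eq_zero_of_mass_eq_zero h0.symm]
    rcases t.eq_empty_or_nonempty with rfl | hne
    · simp
    · exact Real.log_nonneg (by exact_mod_cast Nat.one_le_iff_ne_zero.2 (card_ne_zero.2 hne))
  have htne : t.Nonempty := by
    obtain ⟨i, hi⟩ := nonempty_of_mass_pos hpos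
    exact ⟨X i, ht (mem_image_of_mem X hi)⟩
  have hN : (0 : ℝ) < #t := by exact_mod_cast card_pos.2 htne
  rw [ent_eq_sum_of_subset ht]
  have hsum1 : ∑ a ∈ t, prob s w X a = 1 := sum_prob_eq_one hpos ht
  have key : ∀ a ∈ t, negMulLog (prob s w X a) - prob s w X a * Real.log (#t) ≤
      1 / #t - prob s w X a := by
    intro a _
    rcases (prob_nonneg hw a : 0 ≤ prob s w X a).eq_or_lt with hp0 | hp
    · rw [← hp0]; simp [hN.le]
    · have hq : 0 < (#t * prob s w X a)⁻¹ := by positivity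
      have hlog := Real.log_le_sub_one_of_pos hq
      rw [Real.log_inv, Real.log_mul hN.ne' hp.ne'] at hlog
      have : negMulLog (prob s w X a) - prob s w X a * Real.log (#t) =
          prob s w X a * (-(Real.log (#t) + Real.log (prob s w X a))) := by
        rw [negMulLog]; ring
      rw [this]
      calc prob s w X a * (-(Real.log (#t) + Real.log (prob s w X a)))
          ≤ prob s w X a * ((#t * prob s w X a)⁻¹ - 1) :=
            mul_le_mul_of_nonneg_left hlog hp.le
        _ = 1 / #t - prob s w X a := by field_simp
  have h := sum_le_sum key
  rw [sum_sub_distrib, ← sum_mul, hsum1, one_mul, sum_sub_distrib, hsum1, sum_const,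
    nsmul_eq_mul, mul_one_div, div_self hN.ne'] at h
  linarith

/-- Unfolding `condEnt`. [folklore] -/
theorem condEnt_def (s : Finset ι) (w : ι → ℝ) (X : ι → α) (Y : ι → β) :
    condEnt s w X Y = ∑ b ∈ s.image Y, prob s w Y b * ent (s.filter fun i => Y i = b) w X :=
  rfl

/-- The conditional entropy may be computed by summing over any finite set containing `Y(s)`.
[folklore] -/
theorem condEnt_eq_sum_of_subset {t : Finset β} (ht : s.image Y ⊆ t) :
    condEnt s w X Y = ∑ b ∈ t, prob s w Y b * ent (s.filter fun i => Y i = b) w X := by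
  unfold condEnt
  refine sum_subset ht fun b _ hb => ?_
  rw [prob_eq_zero_of_not_mem_image hb, zero_mul]

/-- `H[X | Y] ≥ 0`. [folklore] -/
theorem condEnt_nonneg (hw : ∀ i ∈ s, 0 ≤ w i) : 0 ≤ condEnt s w X Y :=
  sum_nonneg fun b _ => mul_nonneg (prob_nonneg hw b)
    (ent_nonneg fun i hi => hw i (mem_of_mem_filter i hi))

/-- The image of `s` under the pair map lies in the product of the images. [folklore] -/
theorem image_pair_subset_product :
    s.image (fun i => (X i, Y i)) ⊆ s.image X ×ˢ s.image Y := by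
  intro c hc
  obtain ⟨i, hi, rfl⟩ := mem_image.1 hc
  exact mem_product.2 ⟨mem_image_of_mem X hi, mem_image_of_mem Y hi⟩

/-- If `P(Y = b) > 0` (nonnegative weights) then the fibre `{Y = b}` has positive mass.
[folklore] -/
theorem mass_fiber_pos_of_prob_pos (hw : ∀ i ∈ s, 0 ≤ w i) {b : β} (h : 0 < prob s w Y b) :
    0 < mass (s.filter fun i => Y i = b) w := by
  rw [prob_def] at h
  have h1 : 0 ≤ mass (s.filter fun i => Y i = b) w :=
    mass_nonneg fun i hi => hw i (mem_of_mem_filter i hi)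
  rcases h1.eq_or_lt with h2 | h2
  · rw [← h2, zero_div] at h; exact absurd h (lt_irrefl 0)
  · exact h2

/-- **Chain rule** (Tao 2016, (3.1)): `H[X, Y] = H[Y] + H[X | Y]`. [cite: TaoFMP2016, §3 (3.1)] -/
theorem ent_pair_eq_add_condEnt (hw : ∀ i ∈ s, 0 ≤ w i) :
    ent s w (fun i => (X i, Y i)) = ent s w Y + condEnt s w X Y := by
  rw [ent_eq_sum_of_subset (image_pair_subset_product (X := X) (Y := Y)), sum_product_right,
    ent_def s w Y, condEnt_def, ← sum_add_distrib]
  refine sum_congr rfl fun b _ => ?_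
  set sb := s.filter fun i => Y i = b with hsb
  have hwb : ∀ i ∈ sb, 0 ≤ w i := fun i hi => hw i (mem_of_mem_filter i hi)
  have himb : sb.image X ⊆ s.image X := image_subset_image (filter_subset _ _)
  have hmul : ∀ a, prob s w (fun i => (X i, Y i)) (a, b) = prob s w Y b * prob sb w X a :=
    fun a => prob_pair_eq_mul hw Y a b
  simp_rw [hmul, negMulLog_mul, sum_add_distrib, ← sum_mul, ← mul_sum]
  rcases (prob_nonneg hw b : 0 ≤ prob s w Y b).eq_or_lt with hp0 | hp
  · rw [← hp0]; simp
  · have hmass : 0 < mass sb w := mass_fiber_pos_of_prob_pos hw hp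
    rw [sum_prob_eq_one hmass himb, one_mul, ← ent_eq_sum_of_subset himb]

/-- **Conditioning does not increase entropy** (Tao 2016, (3.3)): `H[X | Y] ≤ H[X]`, by the
concavity of `-x log x` (Jensen). [cite: TaoFMP2016, §3 (3.3)] -/
theorem condEnt_le_ent (hw : ∀ i ∈ s, 0 ≤ w i) : condEnt s w X Y ≤ ent s w X := by
  rcases (mass_nonneg hw).eq_or_lt with h0 | hpos
  · -- total mass zero: everything vanishes
    have : condEnt s w X Y = 0 := by
      unfold condEnt
      refine sum_eq_zero fun b _ => ?_
      rw [prob_def, ← h0, div_zero, zero_mul]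
    rw [this]
    exact ent_nonneg hw
  set t := s.image X with ht
  -- rewrite `H[X|Y]` as `∑_a ∑_b p_b φ(P_b(a))`
  have h1 : condEnt s w X Y =
      ∑ a ∈ t, ∑ b ∈ s.image Y, prob s w Y b * negMulLog (prob (s.filter fun i => Y i = b) w X a) := by
    rw [condEnt_def, sum_comm]
    refine sum_congr rfl fun b _ => ?_
    rw [ent_eq_sum_of_subset (image_subset_image (filter_subset _ _) : _ ⊆ t), mul_sum]
  rw [h1, ent_def]
  refine sum_le_sum fun a _ => ?_
  -- Jensen for the concave function `negMulLog` with weights `p_b`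
  have hJ := (concaveOn_negMulLog.le_map_sum (t := s.image Y) (w := fun b => prob s w Y b)
    (p := fun b => prob (s.filter fun i => Y i = b) w X a)
    (fun b _ => prob_nonneg hw b) (sum_prob_eq_one hpos subset_rfl)
    (fun b _ => Set.mem_Ici.2 (prob_nonneg (fun i hi => hw i (mem_of_mem_filter i hi)) a)))
  simp only [smul_eq_mul] at hJ
  refine hJ.trans (le_of_eq ?_)
  congr 1
  -- law of total probability: `∑_b p_b P_b(a) = P(a)`
  rw [prob_eq_sum_prob_pair (Y := Y) (t := s.image Y) fun i hi => mem_image_of_mem Y hi]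
  refine sum_congr rfl fun b _ => ?_
  rw [prob_pair_eq_mul hw Y a b]

/-- **Subadditivity** (Tao 2016, (3.4)): `H[X, Y] ≤ H[X] + H[Y]`. [cite: TaoFMP2016, §3 (3.4)] -/
theorem ent_pair_le_add (hw : ∀ i ∈ s, 0 ≤ w i) :
    ent s w (fun i => (X i, Y i)) ≤ ent s w X + ent s w Y := by
  rw [ent_pair_eq_add_condEnt hw, add_comm]
  exact add_le_add_left (condEnt_le_ent (X := X) (Y := Y) hw) _

/-- Entropy is invariant under relabelling the values by a map injective on `X(s)`.
[folklore] -/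
theorem ent_comp_of_injOn {f : α → γ} (hf : Set.InjOn f (s.image X)) :
    ent s w (f ∘ X) = ent s w X := by
  unfold ent
  rw [← image_image, sum_image fun a ha b hb h => hf ha hb h]
  refine sum_congr rfl fun a ha => ?_
  have hfil : s.filter (fun i => (f ∘ X) i = f a) = s.filter (fun i => X i = a) := by
    ext i
    simp only [mem_filter, Function.comp_apply, and_congr_right_iff]
    exact fun hi => ⟨fun h => hf (mem_image_of_mem X hi) ha h, fun h => by rw [h]⟩
  unfold prob
  rw [hfil]

/-- `H[Y, X] = H[X, Y]`. [folklore] -/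
theorem ent_pair_comm : ent s w (fun i => (Y i, X i)) = ent s w (fun i => (X i, Y i)) := by
  have : (fun i => (Y i, X i)) = Prod.swap ∘ fun i => (X i, Y i) := rfl
  rw [this, ent_comp_of_injOn Prod.swap_injective.injOn]

/-- Adjoining a function of `X` does not change the entropy: `H[X, f(X)] = H[X]`. [folklore] -/
theorem ent_pair_apply_eq (f : α → γ) : ent s w (fun i => (X i, f (X i))) = ent s w X := by
  have : (fun i => (X i, f (X i))) = (fun a => (a, f a)) ∘ X := rfl
  rw [this, ent_comp_of_injOn]
  intro a _ b _ h
  exact (Prod.mk.injEq _ _ _ _ ▸ h).1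

/-- Unfolding `mutualInfo`. [folklore] -/
theorem mutualInfo_def (s : Finset ι) (w : ι → ℝ) (X : ι → α) (Y : ι → β) :
    mutualInfo s w X Y = ent s w X + ent s w Y - ent s w (fun i => (X i, Y i)) := rfl

/-- `I[X : Y] = H[X] - H[X | Y]` (Tao 2016, (3.5)). [cite: TaoFMP2016, §3 (3.5)] -/
theorem mutualInfo_eq_ent_sub_condEnt (hw : ∀ i ∈ s, 0 ≤ w i) :
    mutualInfo s w X Y = ent s w X - condEnt s w X Y := by
  rw [mutualInfo_def, ent_pair_eq_add_condEnt hw]; ring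

/-- `I[X : Y] = H[Y] - H[Y | X]` (Tao 2016, (3.5)). [cite: TaoFMP2016, §3 (3.5)] -/
theorem mutualInfo_eq_ent_sub_condEnt' (hw : ∀ i ∈ s, 0 ≤ w i) :
    mutualInfo s w X Y = ent s w Y - condEnt s w Y X := by
  rw [mutualInfo_def, ← ent_pair_comm, ent_pair_eq_add_condEnt hw]; ring

/-- `I[X : Y] = I[Y : X]`. [folklore] -/
theorem mutualInfo_comm : mutualInfo s w X Y = mutualInfo s w Y X := by
  rw [mutualInfo_def, mutualInfo_def, ent_pair_comm]; ring

/-- `I[X : Y] ≥ 0`. [cite: TaoFMP2016, §3 (after (3.5))] -/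
theorem mutualInfo_nonneg (hw : ∀ i ∈ s, 0 ≤ w i) : 0 ≤ mutualInfo s w X Y := by
  rw [mutualInfo_eq_ent_sub_condEnt hw]
  linarith [condEnt_le_ent (X := X) (Y := Y) hw]

/-- `I[X : Y] ≤ H[Y]`. [folklore] -/
theorem mutualInfo_le_ent_right (hw : ∀ i ∈ s, 0 ≤ w i) : mutualInfo s w X Y ≤ ent s w Y := by
  rw [mutualInfo_eq_ent_sub_condEnt' hw]
  linarith [condEnt_nonneg (X := Y) (Y := X) hw]

end Ent

section Cond

variable [DecidableEq α] [DecidableEq β] [DecidableEq γ] {s : Finset ι} {w : ι → ℝ} {X : ι → α}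
  {Y : ι → β} {Z : ι → γ}

/-- Conditional entropy is invariant under relabelling the conditioning variable by a map
injective on `Y(s)` ("conveys exactly the same information"). [cite: TaoFMP2016, §3 (proof of (3.13))] -/
theorem condEnt_comp_right_of_injOn {δ' : Type*} [DecidableEq δ'] {f : β → δ'}
    (hf : Set.InjOn f (s.image Y)) : condEnt s w X (f ∘ Y) = condEnt s w X Y := by
  unfold condEnt
  rw [← image_image, sum_image fun a ha b hb h => hf ha hb h]
  refine sum_congr rfl fun b hb => ?_
  have hfil : s.filter (fun i => (f ∘ Y) i = f b) = s.filter (fun i => Y i = b) := by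
    ext i
    simp only [mem_filter, Function.comp_apply, and_congr_right_iff]
    exact fun hi => ⟨fun h => hf (mem_image_of_mem Y hi) hb h, fun h => by rw [h]⟩
  rw [hfil]
  congr 1
  unfold prob
  rw [hfil]

/-- Conditional entropy is invariant under relabelling the variable by a map injective on
`X(s)`. [folklore] -/
theorem condEnt_comp_left_of_injOn {f : α → γ} (hf : Set.InjOn f (s.image X)) :
    condEnt s w (f ∘ X) Y = condEnt s w X Y := by
  unfold condEnt
  refine sum_congr rfl fun b _ => ?_
  rw [ent_comp_of_injOn (hf.mono ?_)]
  exact coe_subset.2 (image_subset_image (filter_subset _ _))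

/-- **Relative subadditivity** (Tao 2016, (3.6)): `H[X, Y | Z] ≤ H[X | Z] + H[Y | Z]`.
[cite: TaoFMP2016, §3 (3.6)] -/
theorem condEnt_pair_le_add (hw : ∀ i ∈ s, 0 ≤ w i) :
    condEnt s w (fun i => (X i, Y i)) Z ≤ condEnt s w X Z + condEnt s w Y Z := by
  unfold condEnt
  rw [← sum_add_distrib]
  refine sum_le_sum fun c _ => ?_
  rw [← mul_add]
  exact mul_le_mul_of_nonneg_left
    (ent_pair_le_add fun i hi => hw i (mem_of_mem_filter i hi)) (prob_nonneg hw c)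

/-- `H[X] = H[X | Y] + I[X : Y] ≤ H[X | Y] + H[Y]` (used in Tao 2016, proof of (3.13)).
[cite: TaoFMP2016, §3 (proof of (3.13))] -/
theorem ent_le_condEnt_add_ent (hw : ∀ i ∈ s, 0 ≤ w i) :
    ent s w X ≤ condEnt s w X Y + ent s w Y := by
  have h1 := mutualInfo_eq_ent_sub_condEnt (X := X) (Y := Y) hw
  have h2 := mutualInfo_le_ent_right (X := X) (Y := Y) hw
  linarith

/-- The mutual information as an average of entropy drops over the fibres of `X`:
`I[X : Y] = ∑_x P(X = x) (H[Y] - H[Y | X = x])` (positive total weight).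
[cite: TaoFMP2016, §3 (after (3.12))] -/
theorem mutualInfo_eq_sum_fiber (hw : ∀ i ∈ s, 0 ≤ w i) (hs : 0 < mass s w) :
    mutualInfo s w X Y =
      ∑ x ∈ s.image X, prob s w X x * (ent s w Y - ent (s.filter fun i => X i = x) w Y) := by
  rw [mutualInfo_eq_ent_sub_condEnt' hw, condEnt_def]
  simp_rw [mul_sub]
  rw [sum_sub_distrib, ← sum_mul, sum_prob_eq_one hs subset_rfl, one_mul]

/-- **Entropy and a distinguished set of values.** If `Y(s) ⊆ t` then for any finite set `T`
of values, writing `p = P(Y ∈ T)`,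
`H[Y] ≤ log 2 + p log #T + (1 - p) log #t`: condition on the event `Y ∈ T` (chain rule) and use
`H ≤ log N` on each of the two fibres (this is the computation in the proof of Tao 2016,
Lemma 3.3). [cite: TaoFMP2016, §3 (proof of Lemma 3.3)] -/
theorem ent_le_of_event (hw : ∀ i ∈ s, 0 ≤ w i) {t : Finset β} (ht : s.image Y ⊆ t)
    (T : Finset β) :
    ent s w Y ≤ Real.log 2 + prob s w (fun i => decide (Y i ∈ T)) true * Real.log (#T) +
      (1 - prob s w (fun i => decide (Y i ∈ T)) true) * Real.log (#t) := by
  set Z : ι → Bool := fun i => decide (Y i ∈ T) with hZ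
  have hT0 : 0 ≤ Real.log (#T) := by
    rcases T.eq_empty_or_nonempty with rfl | hne
    · simp
    · exact Real.log_nonneg (by exact_mod_cast Nat.one_le_iff_ne_zero.2 (card_ne_zero.2 hne))
  have ht0 : 0 ≤ Real.log (#t) := by
    rcases t.eq_empty_or_nonempty with rfl | hne
    · simp
    · exact Real.log_nonneg (by exact_mod_cast Nat.one_le_iff_ne_zero.2 (card_ne_zero.2 hne))
  have hp0 : 0 ≤ prob s w Z true := prob_nonneg hw _
  have hp1 : prob s w Z true ≤ 1 := prob_le_one hw _
  rcases (mass_nonneg hw).eq_or_lt with h0 | hpos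
  · rw [ent_eq_zero_of_mass_eq_zero h0.symm]
    have : 0 ≤ Real.log 2 := Real.log_nonneg one_le_two
    nlinarith
  -- `H[Y] = H[Y, Z] = H[Z] + H[Y | Z]`
  have h1 : ent s w Y = ent s w Z + condEnt s w Y Z := by
    rw [← ent_pair_eq_add_condEnt hw]
    exact (ent_pair_apply_eq (X := Y) (fun b => decide (b ∈ T))).symm
  -- `H[Z] ≤ log 2`
  have h2 : ent s w Z ≤ Real.log 2 := by
    have := ent_le_log_card (X := Z) hw (t := (Finset.univ : Finset Bool)) (subset_univ _)
    simpa using this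
  -- `H[Y | Z] ≤ P(Z = true) log #T + P(Z = false) log #t`
  have h3 : condEnt s w Y Z ≤ prob s w Z true * Real.log (#T) +
      (1 - prob s w Z true) * Real.log (#t) := by
    have huniv : s.image Z ⊆ (Finset.univ : Finset Bool) := subset_univ _
    rw [condEnt_eq_sum_of_subset huniv]
    have hsum : ∑ c ∈ (Finset.univ : Finset Bool), prob s w Z c = 1 := sum_prob_eq_one hpos huniv
    simp only [Fintype.univ_bool, mem_singleton, Bool.true_eq_false, not_false_eq_true,
      sum_insert, sum_singleton] at hsum ⊢
    have hfalse : prob s w Z false = 1 - prob s w Z true := by linarith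
    rw [hfalse]
    refine add_le_add (mul_le_mul_of_nonneg_left (ent_le_log_card
      (fun i hi => hw i (mem_of_mem_filter i hi)) ?_) hp0)
      (mul_le_mul_of_nonneg_left (ent_le_log_card (fun i hi => hw i (mem_of_mem_filter i hi))
        ((image_subset_image (filter_subset _ _)).trans ht)) (by linarith))
    -- values of `Y` on `{Z = true}` lie in `T`
    intro b hb
    obtain ⟨i, hi, rfl⟩ := mem_image.1 hb
    have := (mem_filter.1 hi).2
    simpa [hZ] using this
  linarith

end Cond

section Continuity

variable [DecidableEq α] [DecidableEq β]

/-- `-x log x` is subadditive on `[0, ∞)`: `φ(a + b) ≤ φ(a) + φ(b)`. [folklore] -/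
theorem negMulLog_add_le {a b : ℝ} (ha : 0 ≤ a) (hb : 0 ≤ b) :
    negMulLog (a + b) ≤ negMulLog a + negMulLog b := by
  rcases ha.eq_or_lt with rfl | ha'
  · simp
  rcases hb.eq_or_lt with rfl | hb'
  · simp
  have hab : 0 < a + b := by linarith
  simp only [negMulLog]
  -- `a log a + b log b - (a+b) log (a+b) = a log (a/(a+b)) + b log (b/(a+b)) ≤ 0`
  have h1 : Real.log a ≤ Real.log (a + b) := Real.log_le_log ha' (by linarith)
  have h2 : Real.log b ≤ Real.log (a + b) := Real.log_le_log hb' (by linarith)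
  nlinarith

/-- For `0 ≤ p ≤ p + d ≤ 1`: `φ(p) - φ(p + d) ≤ d`. [folklore] -/
theorem negMulLog_sub_negMulLog_add_le {p d : ℝ} (hp : 0 ≤ p) (hd : 0 ≤ d) (h1 : p + d ≤ 1) :
    negMulLog p - negMulLog (p + d) ≤ d := by
  rcases hp.eq_or_lt with rfl | hp'
  · simp only [negMulLog_zero, zero_add, zero_sub]
    have : 0 ≤ negMulLog d := negMulLog_nonneg hd (by linarith)
    linarith
  simp only [negMulLog]
  -- `(p+d) log (p+d) - p log p = p log ((p+d)/p) + d log (p+d) ≤ p (d/p) + 0`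
  have hpd : 0 < p + d := by linarith
  have hlog1 : Real.log (p + d) - Real.log p ≤ d / p := by
    rw [← Real.log_div hpd.ne' hp'.ne']
    have h := Real.log_le_sub_one_of_pos (div_pos hpd hp')
    have he : (p + d) / p - 1 = d / p := by field_simp; ring
    linarith
  have hlog2 : Real.log (p + d) ≤ 0 := Real.log_nonpos hpd.le h1
  have := mul_le_mul_of_nonneg_left hlog1 hp
  rw [mul_sub, mul_div_cancel₀ _ hp'.ne'] at this
  nlinarith

/-- **Continuity of `-x log x` on `[0, 1]`**: `|φ(p) - φ(q)| ≤ φ(|p - q|) + |p - q|`.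
[folklore] -/
theorem abs_negMulLog_sub_le {p q : ℝ} (hp : 0 ≤ p) (hp1 : p ≤ 1) (hq : 0 ≤ q) (hq1 : q ≤ 1) :
    |negMulLog p - negMulLog q| ≤ negMulLog |p - q| + |p - q| := by
  wlog hpq : p ≤ q generalizing p q
  · have := this hq hq1 hp hp1 (not_le.mp hpq).le
    simpa only [abs_sub_comm] using this
  have hd0 : 0 ≤ q - p := by linarith
  rw [abs_sub_comm p q, abs_of_nonneg hd0]
  have hA := negMulLog_add_le hp hd0
  have hB := negMulLog_sub_negMulLog_add_le hp hd0 (by linarith)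
  have hφd : 0 ≤ negMulLog (q - p) := negMulLog_nonneg hd0 (by linarith)
  rw [add_sub_cancel] at hA hB
  rw [abs_le]
  constructor <;> linarith

/-- **Continuity of entropy in the distribution.** If two random variables (possibly on
different finite weighted sets) take values in `t` and their laws differ by at most `δ ≤ 1`
pointwise on `t`, then their entropies differ by at most `#t (φ(δ) + δ)`. [folklore] -/
theorem abs_ent_sub_ent_le {ι' : Type*} {s : Finset ι} {w : ι → ℝ} {X : ι → α}
    {s' : Finset ι'} {w' : ι' → ℝ} {X' : ι' → α} (hw : ∀ i ∈ s, 0 ≤ w i)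
    (hw' : ∀ i ∈ s', 0 ≤ w' i) {t : Finset α} (ht : s.image X ⊆ t) (ht' : s'.image X' ⊆ t)
    {δ : ℝ} (hδ1 : δ ≤ 1) (hclose : ∀ a ∈ t, |prob s w X a - prob s' w' X' a| ≤ δ) :
    |ent s w X - ent s' w' X'| ≤ #t * (negMulLog δ + δ) := by
  rw [ent_eq_sum_of_subset ht, ent_eq_sum_of_subset ht', ← sum_sub_distrib]
  refine (abs_sum_le_sum_abs _ _).trans ?_
  rcases t.eq_empty_or_nonempty with rfl | ⟨a₀, ha₀⟩
  · simp
  have hδ0 : 0 ≤ δ := (abs_nonneg _).trans (hclose a₀ ha₀)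
  calc ∑ a ∈ t, |negMulLog (prob s w X a) - negMulLog (prob s' w' X' a)|
      ≤ ∑ a ∈ t, (negMulLog δ + δ) := by
        refine sum_le_sum fun a ha => ?_
        have h := abs_negMulLog_sub_le (prob_nonneg (X := X) hw a) (prob_le_one (X := X) hw a)
          (prob_nonneg (X := X') hw' a) (prob_le_one (X := X') hw' a)
        refine h.trans ?_
        have hx := hclose a ha
        have hx0 : 0 ≤ |prob s w X a - prob s' w' X' a| := abs_nonneg _
        -- `φ` is monotone on `[0, e⁻¹]`? Not needed: use `φ(u) ≤ φ(δ) + (δ - u)`? We use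
        -- `φ(u) - φ(δ) ≤ δ - u` from `negMulLog_sub_negMulLog_add_le`.
        have := negMulLog_sub_negMulLog_add_le hx0 (by linarith : 0 ≤ δ - |prob s w X a -
          prob s' w' X' a|) (by linarith)
        rw [add_sub_cancel] at this
        linarith
    _ = #t * (negMulLog δ + δ) := by rw [sum_const, nsmul_eq_mul]

end Continuity

section Misc

variable [DecidableEq α] [DecidableEq γ] {s : Finset ι} {w : ι → ℝ} {X : ι → α}

/-- `P(X = a)` as a normalised weighted sum of an indicator. [folklore] -/
theorem prob_eq_sum_ite (s : Finset ι) (w : ι → ℝ) (X : ι → α) (a : α) :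
    prob s w X a = (∑ i ∈ s, if X i = a then w i else 0) / mass s w := by
  rw [prob_def, mass_def, sum_filter]

/-- Probabilities are invariant under injective relabelling of the values. [folklore] -/
theorem prob_comp_of_injective {f : α → γ} (hf : Function.Injective f) (a : α) :
    prob s w (f ∘ X) (f a) = prob s w X a := by
  unfold prob
  congr 2
  ext i
  simp only [mem_filter, Function.comp_apply, hf.eq_iff]

/-- **Entropy of a uniform distribution**: for constant positive weights and `X` injective on
`s`, `H[X] = log #s`. [folklore] -/
theorem ent_eq_log_card_of_uniform {c : ℝ} (hc : 0 < c) (hw : ∀ i ∈ s, w i = c)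
    (hX : Set.InjOn X s) : ent s w X = Real.log (#s) := by
  rcases s.eq_empty_or_nonempty with rfl | hne
  · simp [ent_def]
  have hN : (0 : ℝ) < #s := by exact_mod_cast card_pos.2 hne
  have hmass : mass s w = c * #s := by
    rw [mass_def, sum_congr rfl hw, sum_const, nsmul_eq_mul, mul_comm]
  have hprob : ∀ a ∈ s.image X, prob s w X a = 1 / #s := by
    intro a ha
    obtain ⟨i, hi, rfl⟩ := mem_image.1 ha
    have hfil : s.filter (fun j => X j = X i) = {i} := by
      ext j
      simp only [mem_filter, mem_singleton]
      exact ⟨fun h => hX h.1 hi h.2, fun h => by rw [h]; exact ⟨hi, rfl⟩⟩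
    rw [prob_def, hfil, mass_def, sum_singleton, hw i hi, hmass]
    field_simp
  rw [ent_def, sum_congr rfl fun a ha => by rw [hprob a ha], sum_const, card_image_of_injOn hX,
    nsmul_eq_mul, negMulLog, one_div, Real.log_inv]
  field_simp

end Misc

section LowerBounds

variable [DecidableEq α] [DecidableEq β] {s : Finset ι} {w : ι → ℝ} {X : ι → α}

/-- A lower bound for entropy from an upper bound on the atoms: if every value has probability
at most `q`, then `H[X] ≥ -log q` (`= ∑ p log(1/p) ≥ ∑ p log(1/q)`). [folklore] -/
theorem neg_log_le_ent (hw : ∀ i ∈ s, 0 ≤ w i) (hs : 0 < mass s w) {q : ℝ}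
    (h : ∀ a ∈ s.image X, prob s w X a ≤ q) : -Real.log q ≤ ent s w X := by
  rw [ent_def]
  have hsum := sum_prob_eq_one (X := X) hs subset_rfl
  calc -Real.log q = ∑ a ∈ s.image X, prob s w X a * (-Real.log q) := by
        rw [← sum_mul, hsum, one_mul]
    _ ≤ ∑ a ∈ s.image X, negMulLog (prob s w X a) := by
        refine sum_le_sum fun a ha => ?_
        have hp0 : 0 ≤ prob s w X a := prob_nonneg hw a
        rw [negMulLog, neg_mul, mul_neg, neg_le_neg_iff]
        rcases hp0.eq_or_lt with h0 | hpos
        · rw [← h0]; simp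
        · exact mul_le_mul_of_nonneg_left (Real.log_le_log hpos (h a ha)) hp0

/-- The entropy of a random variable taking at most one value on `s` vanishes. [folklore] -/
theorem ent_eq_zero_of_subsingleton (hw : ∀ i ∈ s, 0 ≤ w i) {c : α} (h : ∀ i ∈ s, X i = c) :
    ent s w X = 0 := by
  apply le_antisymm _ (ent_nonneg hw)
  have hsub : s.image X ⊆ {c} := by
    intro a ha
    obtain ⟨i, hi, rfl⟩ := mem_image.1 ha
    rw [mem_singleton, h i hi]
  have := ent_le_log_card hw hsub
  simpa using this

/-- The conditional entropy of a random variable taking at most one value vanishes. [folklore] -/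
theorem condEnt_eq_zero_of_subsingleton {Y : ι → β}
    (hw : ∀ i ∈ s, 0 ≤ w i) {c : α} (h : ∀ i ∈ s, X i = c) : condEnt s w X Y = 0 := by
  rw [condEnt_def]
  refine sum_eq_zero fun b _ => ?_
  rw [ent_eq_zero_of_subsingleton (fun i hi => hw i (mem_of_mem_filter i hi))
    (fun i hi => h i (mem_of_mem_filter i hi)), mul_zero]


/-- Probabilities only depend on the values of the random variable on `s`. [folklore] -/
theorem prob_congr {X X' : ι → α} (h : ∀ i ∈ s, X i = X' i) (a : α) :
    prob s w X a = prob s w X' a := by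
  unfold prob
  rw [filter_congr fun i hi => by rw [h i hi]]

/-- **Weak uniform distribution, averaged over the conditioning** (the content of Tao 2016,
Lemma 3.3 and of the Markov step preceding it, in one inequality). Let `Y` take values in
`[0, P)` and let `E_x ⊆ ℕ` be sets with `#E_x ≤ e^{-B} P` (`B > 0`). Then
`P(Y ∈ E_X) ≤ (log 2 + (log P - H[Y]) + I[X : Y]) / B`:
on each fibre `{X = x}`, `H[Y | X = x] ≤ log 2 + log P - B · P(Y ∈ E_x | X = x)` by conditioning on
the event `Y ∈ E_x`, and averaging over `x` gives `B · P(Y ∈ E_X) ≤ log 2 + log P - H[Y | X]`.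
[cite: TaoFMP2016, §3 Lemma 3.3] -/
theorem prob_mem_le_of_mutualInfo (hw : ∀ i ∈ s, 0 ≤ w i) (hs : 0 < mass s w) {X : ι → α}
    {Y : ι → ℕ} {P : ℕ} (hP : 0 < P) (hY : s.image Y ⊆ Finset.range P) (E : α → Finset ℕ)
    {B : ℝ} (hB : 0 < B) (hE : ∀ x, (#(E x) : ℝ) ≤ Real.exp (-B) * P) :
    prob s w (fun i => decide (Y i ∈ E (X i))) true ≤
      (Real.log 2 + (Real.log P - ent s w Y) + mutualInfo s w X Y) / B := by
  set Z : ι → Bool := fun i => decide (Y i ∈ E (X i)) with hZ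
  have hP0 : (0 : ℝ) < P := by exact_mod_cast hP
  -- decompose `P(Z = true)` along `X`
  have hdec : prob s w Z true = ∑ x ∈ s.image X, prob s w X x *
      prob (s.filter fun i => X i = x) w Z true := by
    rw [prob_eq_sum_prob_pair (X := Z) (Y := X) (t := s.image X) (fun i hi => mem_image_of_mem X hi)]
    refine sum_congr rfl fun x _ => ?_
    exact prob_pair_eq_mul hw X true x
  -- on each fibre
  have hfib : ∀ x ∈ s.image X, B * prob (s.filter fun i => X i = x) w Z true ≤
      Real.log 2 + Real.log P - ent (s.filter fun i => X i = x) w Y := by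
    intro x _
    set sx := s.filter fun i => X i = x with hsx
    have hwx : ∀ i ∈ sx, 0 ≤ w i := fun i hi => hw i (mem_of_mem_filter i hi)
    have hZx : prob sx w Z true = prob sx w (fun i => decide (Y i ∈ E x)) true := by
      refine prob_congr (fun i hi => ?_) true
      simp only [hZ, (mem_filter.1 hi).2]
    have hYx : sx.image Y ⊆ Finset.range P := (image_subset_image (filter_subset _ _)).trans hY
    have hev := ent_le_of_event (Y := Y) hwx hYx (E x)
    rw [Finset.card_range] at hev
    set q := prob sx w (fun i => decide (Y i ∈ E x)) true with hq
    have hq0 : 0 ≤ q := prob_nonneg hwx _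
    -- `q log #E_x ≤ q (log P - B)`
    have hqlog : q * Real.log (#(E x)) ≤ q * (Real.log P - B) := by
      rcases Nat.eq_zero_or_pos #(E x) with h0 | hpos
      · -- `E x = ∅`, so `q = 0`
        have hq00 : q = 0 := by
          rw [hq, prob_def]
          have : sx.filter (fun i => decide (Y i ∈ E x) = true) = ∅ := by
            rw [filter_eq_empty_iff]
            intro i _
            rw [Finset.card_eq_zero.1 h0]
            simp
          rw [this, mass_def, sum_empty, zero_div]
        rw [hq00]; simp
      · refine mul_le_mul_of_nonneg_left ?_ hq0
        have h1 : Real.log (#(E x)) ≤ Real.log (Real.exp (-B) * P) :=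
          Real.log_le_log (by exact_mod_cast hpos) (hE x)
        rw [Real.log_mul (Real.exp_pos _).ne' hP0.ne', Real.log_exp] at h1
        linarith
    rw [hZx]
    nlinarith [hev, hqlog]
  -- average over `x`
  have hsum1 := sum_prob_eq_one (X := X) hs subset_rfl
  have hcond : condEnt s w Y X = ∑ x ∈ s.image X, prob s w X x * ent (s.filter fun i => X i = x) w Y :=
    rfl
  have hI := mutualInfo_eq_ent_sub_condEnt' (X := X) (Y := Y) hw
  rw [le_div_iff₀ hB, hdec]
  calc (∑ x ∈ s.image X, prob s w X x * prob (s.filter fun i => X i = x) w Z true) * B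
      = ∑ x ∈ s.image X, prob s w X x * (B * prob (s.filter fun i => X i = x) w Z true) := by
        rw [sum_mul]; refine sum_congr rfl fun x _ => ?_; ring
    _ ≤ ∑ x ∈ s.image X, prob s w X x *
        (Real.log 2 + Real.log P - ent (s.filter fun i => X i = x) w Y) :=
        sum_le_sum fun x hx => mul_le_mul_of_nonneg_left (hfib x hx) (prob_nonneg hw x)
    _ = (Real.log 2 + Real.log P) * ∑ x ∈ s.image X, prob s w X x - condEnt s w Y X := by
        rw [hcond, mul_sum, ← sum_sub_distrib]
        refine sum_congr rfl fun x _ => ?_; ring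
    _ = Real.log 2 + (Real.log P - ent s w Y) + mutualInfo s w X Y := by
        rw [hsum1, hI]; ring

end LowerBounds

end FiniteShannon

end Literature.Probability.Entropy

end
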